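import Literature.Probability.RandomPlanarGeometry.ConformalRestrictionProofs
import HarnessLib

/-!
# Crux `SAWDevelopingMap.ObservableToSLE` (stmt-CriticalPhenomena-10472), line
`floor-ratio-restriction-bootstrap`: elementary helpers for the mechanism stub `stub_restrictionCocycle`

Landing target:
`Summits/CriticalPhenomena/SAWScalingLimit/Theorems/SAWDevelopingMapObservableToSLERestrictionCocycleHelpersReal.lean`
(`--supports stmt-CriticalPhenomena-10472`).

* `tendsto_of_forall_squeeze` — the real-analysis squeeze behind the bootstrap: if for every `η > 0`
  the function `f` factors eventually as `f = r · Q` with `Q → R`, `|R - c| ≤ η` and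
  `1 - η ≤ r ≤ 1`, then `f → c`;
* `exists_remark` — re-marking the second point of a Dobrushin domain: for `s ∈ ∂D`, `s ≠ a`, there
  is a Dobrushin domain with the same carrier, the same first marked point `a` and second marked point
  `s` (shift of the boundary parametrisation).
-/

noncomputable section

open scoped Topology
open Filter Set Metric
open Literature.Probability.RandomPlanarGeometry

namespace Summit.CriticalPhenomena.SAWScalingLimit.Theorems.ObservableToSLE.FloorRatio

/-! ### The squeeze -/

/-- **The bootstrap squeeze.**  Let `f : α → ℝ` and `c : ℝ`.  Suppose that for every `η > 0` there
are functions `r, Q` and a number `R` with `|R - c| ≤ η`, `Q → R` along `l`, and eventually along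
`l`: `f = r · Q` and `1 - η ≤ r ≤ 1`.  Then `f → c` along `l`. [folklore] -/
theorem tendsto_of_forall_squeeze {α : Type*} {l : Filter α} {f : α → ℝ} {c : ℝ}
    (h : ∀ η : ℝ, 0 < η → ∃ (r Q : α → ℝ) (R : ℝ), |R - c| ≤ η ∧ Tendsto Q l (𝓝 R) ∧
      ∀ᶠ x in l, f x = r x * Q x ∧ 1 - η ≤ r x ∧ r x ≤ 1) :
    Tendsto f l (𝓝 c) := by
  rw [Metric.tendsto_nhds]
  intro ε hε
  -- choose `η` with `η + η (|c| + 2 η) + η < ε`... we take `η = min 1 (ε / (4 + 2 |c|))`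
  obtain ⟨η, hη, hη1, hηε⟩ : ∃ η : ℝ, 0 < η ∧ η ≤ 1 ∧ η * (3 + |c|) < ε := by
    refine ⟨min 1 (ε / (4 + |c|)), lt_min one_pos (div_pos hε (by positivity)), min_le_left _ _, ?_⟩
    have h1 : min 1 (ε / (4 + |c|)) ≤ ε / (4 + |c|) := min_le_right _ _
    have h2 : 0 ≤ |c| := abs_nonneg c
    calc min 1 (ε / (4 + |c|)) * (3 + |c|) ≤ ε / (4 + |c|) * (3 + |c|) :=
          mul_le_mul_of_nonneg_right h1 (by positivity)
      _ < ε / (4 + |c|) * (4 + |c|) := by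
          apply mul_lt_mul_of_pos_left (by linarith) (div_pos hε (by positivity))
      _ = ε := div_mul_cancel₀ _ (by positivity)
  obtain ⟨r, Q, R, hR, hQ, hev⟩ := h η hη
  have hQ' : ∀ᶠ x in l, dist (Q x) R < η := Metric.tendsto_nhds.1 hQ η hη
  filter_upwards [hev, hQ'] with x hx hQx
  obtain ⟨hf, hr1, hr2⟩ := hx
  rw [Real.dist_eq] at hQx ⊢
  rw [hf]
  have hr0 : 0 ≤ r x := by linarith
  have h1 : |r x * Q x - r x * R| ≤ η := by
    rw [← mul_sub, abs_mul, abs_of_nonneg hr0]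
    calc r x * |Q x - R| ≤ 1 * η := mul_le_mul hr2 hQx.le (abs_nonneg _) zero_le_one
      _ = η := one_mul η
  have h2 : |r x * R - R| ≤ η * (|c| + 1) := by
    rw [show r x * R - R = -((1 - r x) * R) by ring, abs_neg, abs_mul,
      abs_of_nonneg (by linarith : 0 ≤ 1 - r x)]
    have hRle : |R| ≤ |c| + 1 := by
      calc |R| = |(R - c) + c| := by rw [sub_add_cancel]
        _ ≤ |R - c| + |c| := abs_add_le _ _
        _ ≤ |c| + 1 := by linarith
    exact mul_le_mul (by linarith) hRle (abs_nonneg _) hη.le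
  calc |r x * Q x - c| = |(r x * Q x - r x * R) + (r x * R - R) + (R - c)| := by ring_nf
    _ ≤ |r x * Q x - r x * R| + |r x * R - R| + |R - c| := abs_add_three _ _ _
    _ ≤ η + η * (|c| + 1) + η := by linarith
    _ = η * (3 + |c|) := by ring
    _ < ε := hηε

/-! ### Re-marking the second point of a Dobrushin domain -/

/-- Shifting a simple periodic loop keeps it injective on a period. [folklore] -/
-- adapted from `Function.Periodic.injOn_shift` (Literature/…/ArcHullDomains.lean)
theorem injOn_shift_of_periodic {g : ℝ → ℂ} (hp : Function.Periodic g 1) (hinj : InjOn g (Ico 0 1))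
    (c : ℝ) : InjOn (fun t ↦ g (t + c)) (Ico 0 1) := by
  have hfr : ∀ x : ℝ, g (Int.fract x) = g x := fun x ↦ by
    rw [Int.fract]
    have := hp.sub_int_mul_eq (x := x) ⌊x⌋
    rwa [mul_one] at this
  intro s hs t ht hst
  simp only at hst
  rw [← hfr (s + c), ← hfr (t + c)] at hst
  have h1 := hinj ⟨Int.fract_nonneg _, Int.fract_lt_one _⟩ ⟨Int.fract_nonneg _, Int.fract_lt_one _⟩ hst
  obtain ⟨z, hz⟩ := Int.fract_eq_fract.1 h1
  have hz' : (s - t : ℝ) = z := by linarith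
  have habs : |(z : ℝ)| < 1 := by
    rw [← hz', abs_sub_lt_iff]
    exact ⟨by linarith [hs.1, hs.2, ht.1, ht.2], by linarith [hs.1, hs.2, ht.1, ht.2]⟩
  have hz0 : z = 0 := by
    have : |z| < 1 := by exact_mod_cast habs
    exact Int.abs_lt_one_iff.1 this
  rw [hz0, Int.cast_zero, sub_eq_zero] at hz'
  exact hz'

/-- **Re-marking the second point.**  For a Dobrushin domain `(D; a, b)` and a boundary point
`s ∈ ∂D`, `s ≠ a`, there is a Dobrushin domain `(D; a, s)` with the same carrier: shift the boundary
parametrisation so that `a` has parameter `0`, and mark the parameter of `s` in `(0, 1)`.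
[cite: Werner2007, §2 (Dobrushin domains)] -/
theorem exists_remark (D : DobrushinDomain) {s : ℂ} (hs : s ∈ frontier D.carrier)
    (hsa : s ≠ D.pt 0) :
    ∃ D'' : DobrushinDomain, D''.carrier = D.carrier ∧ D''.pt 0 = D.pt 0 ∧ D''.pt 1 = s := by
  set ta : ℝ := D.mark 0 with hta
  -- a parameter of `s`
  rw [← D.range_boundary] at hs
  obtain ⟨tb, htb⟩ := hs
  have hfract : 0 < Int.fract (tb - ta) := by
    rcases (Int.fract_nonneg (tb - ta)).lt_or_eq with h | h
    · exact h
    · exfalso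
      apply hsa
      -- `tb - ta` is an integer, so `s = boundary tb = boundary ta = a`
      have h' : Int.fract (tb - ta) = 0 := h.symm
      rw [Int.fract_eq_iff] at h'
      obtain ⟨-, -, z, hz⟩ := h'
      rw [sub_zero] at hz
      have : tb = ta + z * 1 := by linarith
      rw [← htb, this, MarkedDomain.pt]
      exact D.periodic_boundary.int_mul z ta
  refine ⟨{ carrier := D.carrier
            boundary := fun t ↦ D.boundary (t + ta)
            isOpen := D.isOpen
            isBounded := D.isBounded
            isConnected := D.isConnected
            continuous_boundary := D.continuous_boundary.comp (continuous_id.add continuous_const)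
            periodic_boundary := fun t ↦ by
              show D.boundary (t + 1 + ta) = D.boundary (t + ta)
              rw [add_right_comm]
              exact D.periodic_boundary (t + ta)
            injOn_boundary := injOn_shift_of_periodic D.periodic_boundary D.injOn_boundary ta
            range_boundary := by
              rw [← D.range_boundary]
              ext x
              constructor
              · rintro ⟨t, rfl⟩; exact ⟨t + ta, rfl⟩
              · rintro ⟨t, rfl⟩; exact ⟨t - ta, by simp⟩
            mark := ![0, Int.fract (tb - ta)]
            strictMono_mark := by
              refine Fin.strictMono_iff_lt_succ.2 fun k ↦ ?_
              fin_cases k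
              simpa using hfract
            mark_mem := fun k ↦ by
              fin_cases k
              · simp
              · exact ⟨Int.fract_nonneg (tb - ta), Int.fract_lt_one (tb - ta)⟩ }, rfl, ?_, ?_⟩
  · show D.boundary ((![0, Int.fract (tb - ta)] : Fin 2 → ℝ) 0 + ta) = D.pt 0
    simp only [Matrix.cons_val_zero, zero_add]
    rfl
  · show D.boundary ((![0, Int.fract (tb - ta)] : Fin 2 → ℝ) 1 + ta) = s
    simp only [Matrix.cons_val_one, Matrix.cons_val_fin_one]
    rw [Int.fract, show tb - ta - (⌊tb - ta⌋ : ℝ) + ta = tb - (⌊tb - ta⌋ : ℝ) * 1 by ring,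
      D.periodic_boundary.sub_int_mul_eq ⌊tb - ta⌋]
    exact htb

/-! ### Registered form of the squeeze (sub-goal of `stub_restrictionCocycle`) -/

/-- **Registered sub-goal `stub_restrictionCocycle_squeeze`** (crux item stmt-CriticalPhenomena-10472,
line `floor-ratio-restriction-bootstrap`, mechanism stub `stub_restrictionCocycle`): the bootstrap
squeeze along `δ → 0⁺` (`tendsto_of_forall_squeeze`). [folklore] -/
theorem stub_restrictionCocycle_squeeze : ∀ (f : ℝ → ℝ) (c : ℝ), (∀ η : ℝ, 0 < η →
    ∃ (r Q : ℝ → ℝ) (R : ℝ), |R - c| ≤ η ∧ Tendsto Q (𝓝[>] 0) (𝓝 R) ∧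
      ∀ᶠ x : ℝ in 𝓝[>] 0, f x = r x * Q x ∧ 1 - η ≤ r x ∧ r x ≤ 1) →
    Tendsto f (𝓝[>] 0) (𝓝 c) :=
  fun _ _ h => tendsto_of_forall_squeeze h

end Summit.CriticalPhenomena.SAWScalingLimit.Theorems.ObservableToSLE.FloorRatio

end
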